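import Summits.BirchSwinnertonDyer.BirchSwinnertonDyer.Theorems.TameQuarticSolventSolventPairLowerBoundTprimePadic
import Summits.BirchSwinnertonDyer.Rank1Residual.WAll.TargetAdditiveAtThreeCells
import Literature.NumberTheory.DiophantineGeometry.LocalReductionFiniteBadPlacesProofs
import Literature.NumberTheory.DiophantineGeometry.LocalReductionProofs
import Literature.NumberTheory.EllipticCurves.NeronLocalHeightCompletion
import Mathlib.NumberTheory.RamificationInertia.Valuation
import HarnessLib

/-!
# Route `TameQuarticSolvent`, crux `SolventPairLowerBound` (stmt-BirchSwinnertonDyer-21391), line `birth`: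
# stub `stub_goodReduction` PROVED — a (t′)-at-`3` curve over `ℚ` acquires GOOD reduction at every place
# of ramification index `4` above `3` of every number field

HONEST FRAMING. Theorems only; this file proves the registered stub `stub_goodReduction` (= `StubGoodReduction`
of the birth skeleton `Cruxes/SolventPairLowerBound/Lines/birth.lean`, BY NAME AND SIGNATURE) of the deciding
crux of route `TameQuarticSolvent`; the crux itself (stubs `stub_twistDatum`, `stub_pairGivenGoodField`) stays
OPEN, and BSD is not proved by any of this. No route file is imported.

WHAT.
* `hasGoodReductionAt_baseChange_of_padicValRat` — **the tame descent of a Weierstrass model** (any prime `p`,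
  any `e, k`): if `W/ℚ` has `e · ord_p Δ = 12k` and `e · ord_p aᵢ ≥ i k` for each nonzero coefficient, then
  over every number field `L` and at every place `w ∋ p` with `e(w|p) = e` the rescaled model
  `(ϖ^k, 0, 0, 0) • W_L` (`ϖ` a `w`-uniformiser) is `w`-integral with unit discriminant, so `W_L` has good
  reduction at `w` (`ord_w = e · ord_p` on `ℚ`, Mathlib `valuation_liesOver`; Silverman *AEC* VII.1 Remark 1.1
  and VII.5.1(a), tree `hasGoodReductionAt_of_valuation_le_one_of_valuation_Δ_eq_one`).
* `stub_goodReduction` — for `W/ℚ` globally minimal, elliptic, additive at `3` of census class (t′)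
  (`Addv W 3`, `Additive.SubTprime W 3`): `(W.baseChange L).HasGoodReductionAt v` for every number field `L`
  and every `v ∋ 3` with `v.asIdeal.ramificationIdx ℤ = 4`. Proof: the `3`-adic companion
  (`exists_rat_model_of_subTprime`: Kodaira `III`/`III*` by Papadopoulos's table, Tate's algorithm Steps 2–9,
  Silverman VII.1.3(b), density of `ℤ` in `ℤ₃`) supplies a `ℚ`-model with `ord₃ Δ = 3k` and `4 ord₃ aᵢ ≥ ik`,
  `k ∈ {1, 3}`; apply the descent with `e = 4`. (This is the explicit form of Serre–Tate: tame potentially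
  good reduction of index `e = 4` is realised over every extension of ramification index divisible by `4`.)

References: J. H. Silverman, *AEC* VII.1 (Remark 1.1, Prop. 1.3), VII.5.1; J.-P. Serre, J. Tate, Ann. of Math.
88 (1968) §2; I. Papadopoulos, J. Number Theory 44 (1993) Table III.
-/

-- D-0017: single-problem summit, so `Summit.BirchSwinnertonDyer.BirchSwinnertonDyer.…` repeats a namespace BY DESIGN.
set_option linter.dupNamespace false

noncomputable section

open scoped NumberField

open IsDedekindDomain IsDedekindDomain.HeightOneSpectrum NumberField WeierstrassCurve
  Literature.NumberTheory.EllipticCurves Literature.NumberTheory.EllipticCurves.Rank1Residual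
  Summit.BirchSwinnertonDyer.Rank1Residual.Additive

namespace Summit.BirchSwinnertonDyer.BirchSwinnertonDyer.Theorems.SolventPairLowerBound

/-! ## The tame descent of a rescaled model -/

/-- **Tame descent of a Weierstrass model.** Let `W/ℚ` be elliptic, `p` prime, `e k : ℕ` with
`e · ord_p Δ(W) = 12 k` and, for each `i`, `aᵢ(W) = 0` or `i k ≤ e · ord_p aᵢ(W)`. Then for every number field
`L` and place `w ∋ p` of ramification index `e(w|p) = e`, `W ⊗ L` has good reduction at `w`: with `ϖ` a
`w`-uniformiser, `(ϖ^k, 0, 0, 0) • W_L` has coefficients `ϖ^{-ik} aᵢ` of valuation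
`exp(ik − e · ord_p aᵢ) ≤ 1` and discriminant valuation `exp(12k − e · ord_p Δ) = 1` (`ord_w = e · ord_p` on
`ℚ`, Mathlib `IsDedekindDomain.HeightOneSpectrum.valuation_liesOver`), hence good reduction (Silverman *AEC*
VII.1 Remark 1.1, VII.5.1(a)), which is invariant under the change of variables.
[cite: SilvermanAEC2009, VII.1 Remark 1.1 and Prop. VII.5.1(a)] -/
theorem hasGoodReductionAt_baseChange_of_padicValRat (W : WeierstrassCurve ℚ) [W.IsElliptic]
    (p : ℕ) [hp : Fact p.Prime] {e k : ℕ} (hΔ : (e : ℤ) * padicValRat p W.Δ = 12 * k)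
    (h₁ : W.a₁ = 0 ∨ (k : ℤ) ≤ e * padicValRat p W.a₁)
    (h₂ : W.a₂ = 0 ∨ 2 * (k : ℤ) ≤ e * padicValRat p W.a₂)
    (h₃ : W.a₃ = 0 ∨ 3 * (k : ℤ) ≤ e * padicValRat p W.a₃)
    (h₄ : W.a₄ = 0 ∨ 4 * (k : ℤ) ≤ e * padicValRat p W.a₄)
    (h₆ : W.a₆ = 0 ∨ 6 * (k : ℤ) ≤ e * padicValRat p W.a₆)
    (L : Type) [Field L] [NumberField L] (w : HeightOneSpectrum (𝓞 L))
    (hw : (p : 𝓞 L) ∈ w.asIdeal) (he : w.asIdeal.ramificationIdx ℤ = e) :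
    (W.baseChange L).HasGoodReductionAt w := by
  classical
  -- the place of `ℤ` below `w` is `(p)`
  set v : HeightOneSpectrum ℤ := (Rat.HeightOneSpectrum.primesEquiv (R := ℤ)).symm ⟨p, hp.out⟩
    with hvdef
  have hv : Rat.HeightOneSpectrum.natGenerator v = p :=
    congrArg Subtype.val ((Rat.HeightOneSpectrum.primesEquiv (R := ℤ)).apply_symm_apply ⟨p, hp.out⟩)
  have hvspan : v.asIdeal = Ideal.span {(p : ℤ)} := by
    rw [Rat.HeightOneSpectrum.asIdeal_eq_span_natGenerator_int, hv]
  haveI hlies' : w.asIdeal.LiesOver (Ideal.span {(p : ℤ)}) := liesOver_span_of_natCast_mem p L w hw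
  haveI hlies : w.asIdeal.LiesOver v.asIdeal := by rw [hvspan]; exact hlies'
  haveI := w.isPrime
  have he' : v.asIdeal.ramificationIdx' w.asIdeal = e := by
    rw [Ideal.ramificationIdx'_eq_ramificationIdx _ _ v.ne_bot, he]
  -- `ord_w = e · ord_p` on `ℚ`
  have hval : ∀ x : ℚ, w.valuation L (algebraMap ℚ L x) = v.valuation ℚ x ^ e := fun x ↦ by
    rw [← valuation_liesOver (K := ℚ) L v w x, he']
  have hval' : ∀ {x : ℚ}, x ≠ 0 →
      w.valuation L (algebraMap ℚ L x) = WithZero.exp (-((e : ℤ) * padicValRat p x)) := fun {x} hx ↦ by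
    rw [hval, Rat.HeightOneSpectrum.valuation_eq_exp_neg_padicValRat v hx, hv, ← WithZero.exp_nsmul,
      nsmul_eq_mul, mul_neg]
  -- a `w`-uniformiser and the rescaled model
  obtain ⟨ϖ, hϖ⟩ := w.valuation_exists_uniformizer L
  have hϖ0 : ϖ ≠ 0 := by
    intro h0; rw [h0, map_zero] at hϖ; exact WithZero.exp_ne_zero hϖ.symm
  have hϖk0 : ϖ ^ k ≠ 0 := pow_ne_zero _ hϖ0
  set C : VariableChange L := ⟨Units.mk0 (ϖ ^ k) hϖk0, 0, 0, 0⟩ with hC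
  set X := C • W.baseChange L with hX
  have hCu : (↑C.u⁻¹ : L) = (ϖ ^ k)⁻¹ := by simp [hC]
  have hvu : ∀ i : ℕ, w.valuation L ((↑C.u⁻¹ : L) ^ i) = WithZero.exp ((i * k : ℕ) : ℤ) := fun i ↦ by
    rw [hCu, map_pow, map_inv₀, map_pow, hϖ, ← WithZero.exp_nsmul, ← WithZero.exp_neg,
      ← WithZero.exp_nsmul]
    congr 1
    simp only [nsmul_eq_mul]; push_cast; ring
  -- the coefficients of `X`
  have hXa₁ : X.a₁ = (↑C.u⁻¹ : L) ^ 1 * algebraMap ℚ L W.a₁ := by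
    rw [hX, variableChange_a₁]; simp [hC, WeierstrassCurve.baseChange]
  have hXa₂ : X.a₂ = (↑C.u⁻¹ : L) ^ 2 * algebraMap ℚ L W.a₂ := by
    rw [hX, variableChange_a₂]; simp [hC, WeierstrassCurve.baseChange]
  have hXa₃ : X.a₃ = (↑C.u⁻¹ : L) ^ 3 * algebraMap ℚ L W.a₃ := by
    rw [hX, variableChange_a₃]; simp [hC, WeierstrassCurve.baseChange]
  have hXa₄ : X.a₄ = (↑C.u⁻¹ : L) ^ 4 * algebraMap ℚ L W.a₄ := by
    rw [hX, variableChange_a₄]; simp [hC, WeierstrassCurve.baseChange]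
  have hXa₆ : X.a₆ = (↑C.u⁻¹ : L) ^ 6 * algebraMap ℚ L W.a₆ := by
    rw [hX, variableChange_a₆]; simp [hC, WeierstrassCurve.baseChange]
  have hXΔ : X.Δ = (↑C.u⁻¹ : L) ^ 12 * algebraMap ℚ L W.Δ := by
    rw [hX, variableChange_Δ, WeierstrassCurve.baseChange, map_Δ]
  -- the valuation bound for a coefficient
  have hcoef : ∀ (i : ℕ) (a : ℚ), (a = 0 ∨ (i : ℤ) * k ≤ e * padicValRat p a) →
      w.valuation L ((↑C.u⁻¹ : L) ^ i * algebraMap ℚ L a) ≤ 1 := by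
    intro i a ha
    rcases eq_or_ne a 0 with ha0 | ha0
    · rw [ha0, map_zero, mul_zero, map_zero]; exact zero_le
    have hle : (i : ℤ) * k ≤ e * padicValRat p a := by
      rcases ha with h | h
      · exact absurd h ha0
      · exact h
    rw [map_mul, hvu, hval' ha0, ← WithZero.exp_add, ← WithZero.exp_zero, WithZero.exp_le_exp]
    push_cast; linarith
  have hgood : X.HasGoodReductionAt w := by
    refine X.hasGoodReductionAt_of_valuation_le_one_of_valuation_Δ_eq_one w ?_ ?_ ?_ ?_ ?_ ?_
    · rw [hXa₁]; exact hcoef 1 _ (by simpa using h₁)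
    · rw [hXa₂]; exact hcoef 2 _ (by simpa using h₂)
    · rw [hXa₃]; exact hcoef 3 _ (by simpa using h₃)
    · rw [hXa₄]; exact hcoef 4 _ (by simpa using h₄)
    · rw [hXa₆]; exact hcoef 6 _ (by simpa using h₆)
    · rw [hXΔ, map_mul, hvu, hval' W.isUnit_Δ.ne_zero, ← WithZero.exp_add, ← WithZero.exp_zero]
      congr 1
      push_cast; linarith
  exact (hasGoodReductionAt_smul_iff_holds w (W.baseChange L) C).mp hgood

/-! ## The stub -/

/-- **Stub `stub_goodReduction` of the birth skeleton of crux `SolventPairLowerBound` (route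
`TameQuarticSolvent`), registered signature `StubGoodReduction`.** A globally minimal elliptic curve over `ℚ`
that is additive at `3` of census class (t′) (`¬ PotMult`, `f₃ = 2`, semistability index `∤ 2`, i.e. Kodaira
`III` / `III*`, tame with `e = 4`) acquires GOOD reduction at every place `v ∣ 3` of ramification index
`e(v|3) = 4` of every number field `L` (e.g. the unique place above `3` of `ℚ(3^{1/4})`, `ℚ((−3)^{1/4})` or of the
route's tame quartic solvent field `L″`). Proof: `exists_rat_model_of_subTprime` (a `ℚ`-model with
`ord₃ Δ = 3k`, `4 ord₃ aᵢ ≥ ik`) and the tame descent `hasGoodReductionAt_baseChange_of_padicValRat` with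
`e = 4`. This is the lever "(t′) at 3 ⇒ good reduction at every place with `e(w∣3) = 4`" of the route
(Serre–Tate in explicit form); informally confirmed by the census (QTQ1: `f_w = 0` on 70/70 cells).
[cite: SerreTate1968, §2 Cor. 2] [cite: SilvermanAEC2009, VII.5.1(a)] [cite: Papadopoulos1993, Table III (p = 3)] -/
theorem stub_goodReduction :
    ∀ (W : WeierstrassCurve ℚ) [W.IsElliptic] [W.IsGloballyMinimal], Addv W 3 →
      Summit.BirchSwinnertonDyer.Rank1Residual.Additive.SubTprime W 3 →
    ∀ (L : Type) [Field L] [NumberField L] (v : HeightOneSpectrum (𝓞 L)),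
      ((3 : ℕ) : 𝓞 L) ∈ v.asIdeal → v.asIdeal.ramificationIdx ℤ = 4 →
      (W.baseChange L).HasGoodReductionAt v := by
  intro W _ _ hadd hsub L _ _ v h3 he
  obtain ⟨C, k, -, hΔ, h₁, h₂, h₃, h₄, h₆⟩ := exists_rat_model_of_subTprime W hadd hsub
  haveI : (C • W).IsElliptic := inferInstance
  have hgood : ((C • W).baseChange L).HasGoodReductionAt v :=
    hasGoodReductionAt_baseChange_of_padicValRat (C • W) 3 (e := 4) (k := k)
      (by rw [hΔ]; push_cast; ring) h₁ h₂ h₃ h₄ h₆ L v h3 he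
  have hbc : (C • W).baseChange L = (C.map (algebraMap ℚ L)) • W.baseChange L := by
    rw [WeierstrassCurve.baseChange, ← map_variableChange]; rfl
  rw [hbc] at hgood
  exact (hasGoodReductionAt_smul_iff_holds v (W.baseChange L) _).mp hgood

end Summit.BirchSwinnertonDyer.BirchSwinnertonDyer.Theorems.SolventPairLowerBound

end
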